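import Literature.NumberTheory.EllipticCurves.DeligneSerreSpanHeckeDualityProofs
import Literature.NumberTheory.EllipticCurves.NewformsSpanGamma1Proofs
import Literature.NumberTheory.EllipticCurves.HeckeOperatorsDiamondProofs
import HarnessLib

/-!
# The eigencharacter `θ_f : 𝕋_ℤ → ℂ` of a newform on `Γ₁(N)`

For a newform `f ∈ S_k(Γ₁(N))` (`IsNewform1 f`: a normalised eigenform of all `T_p` and all
`⟨d⟩` in the new subspace) and the Hecke ring `𝕋_ℤ = ℤ[T_p, ⟨d⟩] ⊆ End_ℂ S_k(Γ₁(N))`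
(`heckeRing1 N k`), every `T ∈ 𝕋_ℤ` acts on `f` by a scalar, namely `a₁(T f)`
(`IsNewform1.apply_eq_cuspCoeff_smul`), and `T ↦ a₁(T f)` is a ring homomorphism
`θ_f : 𝕋_ℤ →+* ℂ` (`IsNewform1.eigencharacter`) with `θ_f(T_p) = a_p(f)` and
`θ_f(⟨d⟩) = ε_f(d)` (`eigencharacter_heckeT`, `eigencharacter_diamondOp`). This is the map
"`T_n ↦ a_n` defines a map `𝕋_ℤ → K̄` and induces a `K`-algebra homomorphism `θ_f : 𝕋_K → K̄`"
of Darmon–Diamond–Taylor (*Fermat's Last Theorem*, §4.1, p. 108), whose kernel gives the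
maximal ideal `𝔪` of `𝕋_O` and whose `O`-valued incarnation is the augmentation
`π_f : 𝕋_𝔪 → O` entering the congruence ideal `η_f` (op. cit. (3.3.1) and Remark 3.33: "to
give an `O`-algebra homomorphism `𝕋_Σ → O` is equivalent to giving a newform `f` in `𝒩_Σ` with
coefficients in `O`").

We also record that `θ_f` takes values in the coefficient field `K_f = ℚ(a_n(f), ε_f(n))`
(`coeffCharField f`; `IsNewform1.eigencharacterK`) and, whenever `𝕋_ℤ` is module-finite over
`ℤ` (in the tree an instance in all weights `k ≥ 2`, `heckeRing1.instModuleFinite`), in its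
ring of integers `𝓞_f = coeffCharIntegers f` (`IsNewform1.eigencharacterInt`; the eigenvalues
are algebraic integers because `𝕋_ℤ` is a finite `ℤ`-algebra, Diamond–Shurman Thm. 6.5.1,
Shimura 1971 Thm. 3.48). Composing `eigencharacterInt` with a ring map `𝓞_f → O` (e.g. into the
completion at a prime `λ` of `K_f`) gives the `O`-valued eigensystems `θ : 𝕋_ℤ →+* O` of
`Literature.NumberTheory.Automorphic.HeckeCongruenceIdeal`.

Everything here is proved. Inputs from the tree: the `q`-expansion of `T_p`
(`cuspCoeff_heckeT_gamma1`, from `qExpansion_coeff_heckeT_gamma1_holds`), `⟨1⟩ = id`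
(`diamondOp_one_eq_id`) and `⟨d e⟩ = ⟨d⟩ ⟨e⟩` (`diamondOp_mul_holds`). The identities
`T_p f = a_p f` and `⟨d⟩ f = ε_f(d) f` for newforms are also available in the tree as
`IsNewform1.heckeEigenvalue_eq_coeff_holds` / `IsNewform1.diamondOp_apply_eq_nebentypus_smul`
(`Literature.NumberTheory.Automorphic.LanglandsTunnellLSeriesProofs`); they are re-derived here
in a few lines from the inputs above so that this file does not import the Langlands–Tunnell
development.

## References

* H. Darmon, F. Diamond, R. Taylor, *Fermat's Last Theorem*, Current Developments in Math.
  1995, §1.6 (p. 39), §3.3 Remark 3.33, §4.1 (pp. 107–108). [DarmonDiamondTaylor1995]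
* F. Diamond, J. Shurman, *A first course in modular forms*, GTM 228, Springer 2005: §5.2
  (p. 169), Prop. 5.8.5, Thm. 6.5.1. [DiamondShurman2005]
-/

noncomputable section

open scoped MatrixGroups ModularForm

open CongruenceSubgroup

namespace Literature.NumberTheory.EllipticCurves.ModularForms

variable {N : ℕ} [NeZero N] {k : ℤ} {f : CuspForm (Gamma1 N) k}

/-! ### A newform is an eigenvector of the whole Hecke ring -/

/-- A newform is normalised: `a₁(f) = 1`. [folklore] -/
theorem IsNewform1.cuspCoeff_one (hf : IsNewform1 f) : cuspCoeff f 1 = 1 :=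
  hf.2.2.2

omit [NeZero N] in
/-- The scalar `n ∈ ℤ ⊆ 𝕋_ℤ` acts on `S_k(Γ₁(N))` as multiplication by `n`. [folklore] -/
theorem algebraMap_int_moduleEnd_apply (n : ℤ) (g : CuspForm (Gamma1 N) k) :
    algebraMap ℤ (Module.End ℂ (CuspForm (Gamma1 N) k)) n g = (n : ℂ) • g := by
  rw [Algebra.algebraMap_eq_smul_one, LinearMap.smul_apply, Module.End.one_apply,
    Int.cast_smul_eq_zsmul]

/-- A newform is a simultaneous eigenvector of every element of the Hecke ring
`𝕋_ℤ = ℤ[T_p, ⟨d⟩]` (it is one of each generator, and sums and composites of operators having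
`f` as eigenvector have `f` as eigenvector). [folklore] -/
theorem IsNewform1.exists_apply_eq_smul (hf : IsNewform1 f)
    {T : Module.End ℂ (CuspForm (Gamma1 N) k)} (hT : T ∈ heckeRing1 N k) :
    ∃ c : ℂ, T f = c • f := by
  induction hT using Algebra.adjoin_induction with
  | mem T hT =>
    rcases hT with ⟨p, hp, rfl⟩ | ⟨d, rfl⟩
    · exact hf.2.1 p hp
    · exact hf.2.2.1 d
  | algebraMap n => exact ⟨n, algebraMap_int_moduleEnd_apply n f⟩
  | add S T _ _ hS hT =>
    obtain ⟨a, ha⟩ := hS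
    obtain ⟨b, hb⟩ := hT
    exact ⟨a + b, by rw [LinearMap.add_apply, ha, hb, add_smul]⟩
  | mul S T _ _ hS hT =>
    obtain ⟨a, ha⟩ := hS
    obtain ⟨b, hb⟩ := hT
    exact ⟨b * a, by rw [Module.End.mul_apply, hb, map_smul, ha, smul_smul]⟩

/-- **Eigenvalue = first coefficient.** For a newform `f` and `T ∈ 𝕋_ℤ`:
`T f = a₁(T f) · f` (since `a₁(f) = 1`). [folklore] -/
theorem IsNewform1.apply_eq_cuspCoeff_smul (hf : IsNewform1 f)
    {T : Module.End ℂ (CuspForm (Gamma1 N) k)} (hT : T ∈ heckeRing1 N k) :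
    T f = cuspCoeff (T f) 1 • f := by
  obtain ⟨c, hc⟩ := hf.exists_apply_eq_smul hT
  rw [hc, cuspCoeff_smul_gamma1, hf.cuspCoeff_one, mul_one]

/-- **`T_p f = a_p(f) f`** for a newform and every prime `p` (Diamond–Shurman Prop. 5.8.5):
the eigenvalue is `a₁(T_p f) = a_p(f)` by the `q`-expansion of `T_p` (`cuspCoeff_heckeT_gamma1`,
Diamond–Shurman (5.3)). The same identity is `IsNewform1.heckeEigenvalue_eq_coeff_holds` in the
tree. [cite: DiamondShurman2005, Prop. 5.8.5] -/
theorem IsNewform1.heckeT_apply_eq_cuspCoeff_smul (hf : IsNewform1 f) (p : ℕ) (hp : p.Prime)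
    [NeZero p] : heckeT (Gamma1 N) k p f = cuspCoeff f p • f := by
  have h := hf.apply_eq_cuspCoeff_smul (heckeT_mem_heckeRing1 p hp)
  rwa [cuspCoeff_heckeT_gamma1 f p hp 1, mul_one, if_neg hp.not_dvd_one, mul_zero, ite_self,
    add_zero] at h

/-- **`⟨d⟩ f = ε_f(d) f`** for a newform `f` with nebentypus `ε_f = nebentypus f` and every unit
`d` (Diamond–Shurman §5.2, p. 169: `S_k(Γ₁(N)) = ⊕_χ S_k(N, χ)`): by `IsNewform1`,
`⟨d⟩ f = c(d) f`; as `f ≠ 0`, `⟨1⟩ = id` and `⟨de⟩ = ⟨d⟩⟨e⟩`, `d ↦ c(d)` is a character `χ₀`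
with `f ∈ S_k(N, χ₀)`, so `nebentypus f` is defined by its first branch and `f ∈ S_k(N, ε_f)`.
The same identity is `IsNewform1.diamondOp_apply_eq_nebentypus_smul` in the tree
(Langlands–Tunnell development); re-derived here to keep imports light.
[cite: DiamondShurman2005, §5.2, p. 169] -/
theorem IsNewform1.diamondOp_apply_eq_smul (hf : IsNewform1 f) (d : (ZMod N)ˣ) :
    diamondOp N k (d : ZMod N) f = nebentypus f (d : ZMod N) • f := by
  have hf0 : f ≠ 0 := by
    intro h0
    have h1 := hf.cuspCoeff_one
    have hz := cuspCoeff_smul_gamma1 (0 : ℂ) (0 : CuspForm (Gamma1 N) k) 1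
    rw [zero_smul, zero_mul] at hz
    rw [h0, hz] at h1
    exact zero_ne_one h1
  suffices h : ∃ χ : DirichletCharacter ℂ N, f ∈ nebentypusSubspace N k χ by
    have hmem : f ∈ nebentypusSubspace N k (nebentypus f) := by
      unfold nebentypus
      rw [dif_pos h]
      exact h.choose_spec
    simp only [nebentypusSubspace, Submodule.mem_iInf, LinearMap.mem_ker, LinearMap.sub_apply,
      LinearMap.smul_apply, LinearMap.id_apply, sub_eq_zero] at hmem
    exact hmem d
  choose c hc using hf.2.2.1
  have hsmul : ∀ {a b : ℂ}, a • f = b • f → a = b := fun {a b} h ↦ by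
    by_contra hab
    have h' : (a - b) • f = 0 := by rw [sub_smul, h, sub_self]
    exact hf0 ((smul_eq_zero.mp h').resolve_left (sub_ne_zero.mpr hab))
  have hone : c 1 = 1 := hsmul (by rw [← hc 1, Units.val_one, diamondOp_one_eq_id]; simp)
  have hmul : ∀ d e, c (d * e) = c d * c e := fun d e ↦ hsmul (by
    rw [← hc (d * e), Units.val_mul, diamondOp_mul_holds N k d.isUnit e.isUnit,
      Module.End.mul_apply, hc e, map_smul, hc d, smul_smul, mul_comm])
  have hne : ∀ d, c d ≠ 0 := fun d h0 ↦ by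
    have h := hmul d d⁻¹
    rw [mul_inv_cancel, hone, h0, zero_mul] at h
    exact one_ne_zero h
  let φ : (ZMod N)ˣ →* ℂˣ :=
    { toFun := fun d ↦ Units.mk0 (c d) (hne d)
      map_one' := Units.ext hone
      map_mul' := fun d e ↦ Units.ext (hmul d e) }
  refine ⟨MulChar.ofUnitHom φ, ?_⟩
  rw [nebentypusSubspace, Submodule.mem_iInf]
  intro d
  rw [LinearMap.mem_ker, LinearMap.sub_apply, LinearMap.smul_apply, LinearMap.id_apply,
    MulChar.ofUnitHom_coe, hc d, sub_eq_zero]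
  rfl

/-! ### The eigencharacter -/

/-- **The eigencharacter `θ_f : 𝕋_ℤ →+* ℂ` of a newform `f ∈ S_k(Γ₁(N))`**, `T ↦ a₁(T f)`, the
eigenvalue of `T` on `f` (Darmon–Diamond–Taylor §4.1, p. 108: "`T_n ↦ a_n` defines a map
`𝕋_ℤ → K̄` … `θ_f`"; Shimura 1971, Thm. 3.51, the pairing `(T, f) ↦ a₁(f|T)`).
[cite: DarmonDiamondTaylor1995, §4.1, p. 108] -/
def IsNewform1.eigencharacter (hf : IsNewform1 f) : heckeRing1 N k →+* ℂ where
  toFun T := cuspCoeff ((T : Module.End ℂ (CuspForm (Gamma1 N) k)) f) 1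
  map_one' := by simp [hf.cuspCoeff_one]
  map_mul' S T := by
    simp only [Subalgebra.coe_mul, Module.End.mul_apply]
    rw [hf.apply_eq_cuspCoeff_smul T.2, map_smul, hf.apply_eq_cuspCoeff_smul S.2, smul_smul,
      cuspCoeff_smul_gamma1, cuspCoeff_smul_gamma1, cuspCoeff_smul_gamma1, hf.cuspCoeff_one]
    ring
  map_zero' := by
    have hz := cuspCoeff_smul_gamma1 (0 : ℂ) (0 : CuspForm (Gamma1 N) k) 1
    rw [zero_smul, zero_mul] at hz
    simpa using hz
  map_add' S T := by
    simp only [Subalgebra.coe_add, LinearMap.add_apply, cuspCoeff_add_gamma1]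

/-- Unfolding lemma: `θ_f(T) = a₁(T f)`. [folklore] -/
theorem IsNewform1.eigencharacter_apply (hf : IsNewform1 f) (T : heckeRing1 N k) :
    hf.eigencharacter T = cuspCoeff ((T : Module.End ℂ (CuspForm (Gamma1 N) k)) f) 1 :=
  rfl

/-- Defining property: `T f = θ_f(T) · f` for every `T ∈ 𝕋_ℤ`. [folklore] -/
theorem IsNewform1.apply_eq_eigencharacter_smul (hf : IsNewform1 f) (T : heckeRing1 N k) :
    (T : Module.End ℂ (CuspForm (Gamma1 N) k)) f = hf.eigencharacter T • f :=
  hf.apply_eq_cuspCoeff_smul T.2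

/-- The eigencharacter is determined by the eigenvector property: if `T f = c · f` then
`θ_f(T) = c`. [folklore] -/
theorem IsNewform1.eigencharacter_eq_of_apply_eq_smul (hf : IsNewform1 f)
    {T : Module.End ℂ (CuspForm (Gamma1 N) k)} (hT : T ∈ heckeRing1 N k) {c : ℂ}
    (hc : T f = c • f) : hf.eigencharacter ⟨T, hT⟩ = c := by
  rw [hf.eigencharacter_apply, Subtype.coe_mk, hc, cuspCoeff_smul_gamma1, hf.cuspCoeff_one,
    mul_one]

/-- **`θ_f(T_p) = a_p(f)`** for every prime `p`. [cite: DiamondShurman2005, Prop. 5.8.5] -/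
theorem IsNewform1.eigencharacter_heckeT (hf : IsNewform1 f) (p : ℕ) (hp : p.Prime) [NeZero p] :
    hf.eigencharacter ⟨heckeT (Gamma1 N) k p, heckeT_mem_heckeRing1 p hp⟩ = cuspCoeff f p :=
  hf.eigencharacter_eq_of_apply_eq_smul _ (hf.heckeT_apply_eq_cuspCoeff_smul p hp)

/-- **`θ_f(⟨d⟩) = ε_f(d)`**, the nebentypus of `f`. [cite: DiamondShurman2005, §5.2, p. 169] -/
theorem IsNewform1.eigencharacter_diamondOp (hf : IsNewform1 f) (d : (ZMod N)ˣ) :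
    hf.eigencharacter ⟨diamondOp N k (d : ZMod N), diamondOp_mem_heckeRing1 d⟩ =
      nebentypus f (d : ZMod N) :=
  hf.eigencharacter_eq_of_apply_eq_smul _ (hf.diamondOp_apply_eq_smul d)

/-! ### Values in the coefficient field and its ring of integers -/

/-- `a₁(T f) ∈ K_f = ℚ(a_n(f), ε_f(n))` for every `T ∈ 𝕋_ℤ`: the generators have eigenvalues
`a_p(f)` and `ε_f(d)`, and `K_f` is a subring (Darmon–Diamond–Taylor p. 108: "The image is the
finite extension of `K` generated by the `a_n`"; Diamond–Shurman Def. 6.5.3).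
[cite: DarmonDiamondTaylor1995, §4.1, p. 108] -/
theorem IsNewform1.cuspCoeff_apply_one_mem_coeffCharField (hf : IsNewform1 f)
    {T : Module.End ℂ (CuspForm (Gamma1 N) k)} (hT : T ∈ heckeRing1 N k) :
    cuspCoeff (T f) 1 ∈ coeffCharField f := by
  induction hT using Algebra.adjoin_induction with
  | mem T hT =>
    rcases hT with ⟨p, hp, rfl⟩ | ⟨d, rfl⟩
    · haveI : NeZero p := ⟨hp.ne_zero⟩
      rw [hf.heckeT_apply_eq_cuspCoeff_smul p hp, cuspCoeff_smul_gamma1, hf.cuspCoeff_one,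
        mul_one]
      exact cuspCoeff_mem_coeffCharField f p
    · rw [hf.diamondOp_apply_eq_smul d, cuspCoeff_smul_gamma1, hf.cuspCoeff_one, mul_one,
        ← ZMod.natCast_zmod_val (d : ZMod N)]
      exact nebentypus_mem_coeffCharField f _
  | algebraMap n =>
    rw [algebraMap_int_moduleEnd_apply, cuspCoeff_smul_gamma1, hf.cuspCoeff_one, mul_one]
    exact intCast_mem _ n
  | add S T hS hT ihS ihT =>
    rw [LinearMap.add_apply, cuspCoeff_add_gamma1]
    exact add_mem ihS ihT
  | mul S T hS hT ihS ihT =>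
    rw [Module.End.mul_apply, hf.apply_eq_cuspCoeff_smul hT, map_smul, cuspCoeff_smul_gamma1]
    exact mul_mem ihT ihS

/-- `θ_f` takes values in `K_f`. [cite: DarmonDiamondTaylor1995, §4.1, p. 108] -/
theorem IsNewform1.eigencharacter_mem_coeffCharField (hf : IsNewform1 f) (T : heckeRing1 N k) :
    hf.eigencharacter T ∈ coeffCharField f :=
  hf.cuspCoeff_apply_one_mem_coeffCharField T.2

/-- **The eigencharacter with values in the coefficient field**, `θ_f : 𝕋_ℤ →+* K_f`
(Darmon–Diamond–Taylor §4.1, p. 108). [cite: DarmonDiamondTaylor1995, §4.1, p. 108] -/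
def IsNewform1.eigencharacterK (hf : IsNewform1 f) : heckeRing1 N k →+* coeffCharField f :=
  hf.eigencharacter.codRestrict _ hf.eigencharacter_mem_coeffCharField

/-- `eigencharacterK` is `eigencharacter` with its values regarded in `K_f ⊆ ℂ`. [folklore] -/
@[simp] theorem IsNewform1.coe_eigencharacterK (hf : IsNewform1 f) (T : heckeRing1 N k) :
    (hf.eigencharacterK T : ℂ) = hf.eigencharacter T :=
  rfl

/-- **The Hecke eigenvalues of a newform are algebraic integers** whenever `𝕋_ℤ` is a finitely
generated `ℤ`-module (true in every weight; in the tree an instance for all `k ≥ 2`,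
`heckeRing1.instModuleFinite`): `T` is integral over `ℤ` in `𝕋_ℤ`, hence so is its image
`θ_f(T)` (Diamond–Shurman Thm. 6.5.1; Shimura 1971, Thm. 3.48).
[cite: DiamondShurman2005, Thm. 6.5.1] -/
theorem IsNewform1.isIntegral_eigencharacter [Module.Finite ℤ (heckeRing1 N k)]
    (hf : IsNewform1 f) (T : heckeRing1 N k) : IsIntegral ℤ (hf.eigencharacter T) :=
  (Algebra.IsIntegral.isIntegral (R := ℤ) T).map hf.eigencharacter.toIntAlgHom

/-- The same integrality inside `K_f`. [cite: DiamondShurman2005, Thm. 6.5.1] -/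
theorem IsNewform1.isIntegral_eigencharacterK [Module.Finite ℤ (heckeRing1 N k)]
    (hf : IsNewform1 f) (T : heckeRing1 N k) : IsIntegral ℤ (hf.eigencharacterK T) := by
  have h := hf.isIntegral_eigencharacter T
  rw [← hf.coe_eigencharacterK] at h
  exact (isIntegral_algHom_iff (algebraMap (coeffCharField f) ℂ).toIntAlgHom
    (FaithfulSMul.algebraMap_injective _ _)).mp h

/-- **The eigencharacter with values in the ring of integers `𝓞_f` of `K_f`**,
`θ_f : 𝕋_ℤ →+* 𝓞_f` (for `𝕋_ℤ` module-finite over `ℤ`, e.g. all weights `k ≥ 2`); composed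
with `𝓞_f → 𝓞_{f,λ} = O` it is the `O`-valued eigensystem of `f` at `λ` (Darmon–Diamond–Taylor
Remark 3.33 and §4.1). [cite: DarmonDiamondTaylor1995, §4.1, p. 108] -/
def IsNewform1.eigencharacterInt [Module.Finite ℤ (heckeRing1 N k)] (hf : IsNewform1 f) :
    heckeRing1 N k →+* coeffCharIntegers f :=
  hf.eigencharacterK.codRestrict (integralClosure ℤ (coeffCharField f)).toSubring
    fun T => hf.isIntegral_eigencharacterK T

/-- `eigencharacterInt` is `eigencharacter` with its values regarded in `𝓞_f ⊆ K_f ⊆ ℂ`.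
[folklore] -/
@[simp] theorem IsNewform1.coe_eigencharacterInt [Module.Finite ℤ (heckeRing1 N k)]
    (hf : IsNewform1 f) (T : heckeRing1 N k) :
    ((hf.eigencharacterInt T : coeffCharField f) : ℂ) = hf.eigencharacter T :=
  rfl

end Literature.NumberTheory.EllipticCurves.ModularForms

end
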